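import Mathlib.LinearAlgebra.Matrix.Charpoly.Basic
import Mathlib.LinearAlgebra.Matrix.Charpoly.Coeff
import Mathlib.LinearAlgebra.Matrix.GeneralLinearGroup.Defs
import Literature.NumberTheory.GaloisRepresentations.GaloisRep
import Literature.NumberTheory.GaloisRepresentations.IntegralGaloisActionProofs
import Literature.NumberTheory.Automorphic.SatakeParametersGL
import Literature.NumberTheory.Automorphic.HeckePolynomialSatakeProofs
import HarnessLib

/-!
# Pro-modularity of a Galois representation relative to a big Hecke algebra

Topic `NumberTheory/Automorphic` (definition request `defn-IsProModular`, route
`Langlands/BianchiArtinPoints`, items `OccurrenceArtinTorsion`, `RealizationArtinWeight`; also the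
`GL₄/ℚ` and `PSL₂` Artin cards).

Let `K` be a number field, `n ≥ 0`, and let `𝕋` be a commutative topological ring carrying, for
every finite place `v` outside a finite set `S`, elements `T_{v,1}, …, T_{v,n}` — the images of the
spherical double-coset operators `T_{v,i} = [GL_n(𝒪_v) diag(ϖ_v, …, ϖ_v, 1, …, 1) GL_n(𝒪_v)]`
(`i` entries `ϖ_v`; the normalisation of `Literature.NumberTheory.Automorphic.heckeT`,
`AutomorphicRepData.HasSatakeParamAt`). Such a **Hecke datum** (`HeckeDatum K n 𝕋`) is exactly
what the *big Hecke algebra* `𝕋(K^p) = lim_{s, K_p} (image of the abstract spherical Hecke algebra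
`𝕋^S` in `End ⊕_i H^i(Y(K^pK_p), ℤ/p^s))` of Emerton's completed cohomology of tame level `K^p`
provides ([cite: EmertonCoatesPAMQ2006, Def. 7.3.9 and (61)]; [cite: Pan2022, Def. 3.3.4];
[cite: HansenUniversalEigenvarieties2017, §1.1 and §4.6]); the datum is a PARAMETER here, to be
instantiated by the completed-cohomology construction (separate definition items
`defn-CompletedCohomology*`), which the tree does not have yet.

* `geomFrobPolyOfHecke q n t = ∑_{i=0}^{n} (-1)^i q^{i(i-1)/2} t_i X^{n-i}` over any commutative
  ring: the characteristic polynomial of a GEOMETRIC Frobenius predicted by Hecke eigenvalues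
  `t_i` of the `T_{v,i}` (the tree's `heckePolynomial`, which is the case of `ℂ`; by Tamagawa's
  identity `heckePolynomial_eq_satakePolynomial` its roots are `q^{(n-1)/2} α_j` for the Satake
  parameter `α`, i.e. the Harris–Lan–Taylor–Thorne normalisation `r ↔ π ⊗ |det|^{(1-n)/2}` of
  lang.S27 / `arithFrobPolyOfSatake ι q n α`, whose roots are the inverses, for the ARITHMETIC
  Frobenius).
* `HeckeDatum.IsAssociated H θ ρ` (Hansen's "`ρ` and `φ` are associated",
  [cite: HansenUniversalEigenvarieties2017, Def. 1.2.1]; Emerton's "system of Hecke eigenvalues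
  associated to `V`", [cite: EmertonCoatesPAMQ2006, Def. 7.3.2]): `ρ : Γ_K → GL_n(E)` is
  unramified outside `H.S` and every geometric Frobenius `Frob_v` (`v ∉ S`,
  `Literature.NumberTheory.GaloisRepresentations.IsGeomFrobAt`) has
  `det(X - ρ(Frob_v)) = ∑ (-1)^i (N v)^{i(i-1)/2} θ(T_{v,i}) X^{n-i}`; for `n = 2` this reads
  `tr ρ(Frob_v) = θ(T_v)`, `det ρ(Frob_v) = (N v) θ(S_v)` (`isAssociated_two_iff`), verbatim
  Emerton's `λ(T_ℓ) = trace(Frob_ℓ⁻¹ | V)`, `λ(ℓ S_ℓ) = det(Frob_ℓ⁻¹ | V)` with his arithmetic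
  `Frob_ℓ`.
* `IsProModular H ρ`: there is a CONTINUOUS ring homomorphism `θ : 𝕋 → E` associated with `ρ`
  ([cite: EmertonCoatesPAMQ2006, Def. 7.3.11 and Def. 7.3.15]: "`λ` is promodular if it is the
  composite of `𝕋 → 𝕋̃(K^p)` with a continuous `λ̃ : 𝕋̃(K^p) → A`"; "`V` is promodular if its
  associated system of Hecke eigenvalues is"; equivalently `ρ` corresponds to an `E`-point of
  `Spec 𝕋(K^p)[1/p]`, [cite: Emerton2011LocalGlobal, §6.1 before Prop. 6.1.12]; Hansen's
  `𝒳[ρ] ≠ ∅` is the finite-slope refinement, [cite: HansenUniversalEigenvarieties2017, Conj. 1.2.3];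
  Pan's "pro-modular prime", [cite: Pan2022, 4.1.3]). With `E = 𝒪_E/ϖ^t` (discrete) the same
  predicate expresses "the reduction of `ρ` mod `ϖ^t` carries an eigensystem of `𝕋`", and
  `IsProModular.baseChange` passes from `𝒪_E` to every `𝒪_E/ϖ^t`.

## API

`geomFrobPolyOfHecke_map/_congr/coeff_…/_two/_eq_heckePolynomial/_of_satake`,
`HeckeDatum.frobPoly(_map)`, `IsAssociated.baseChange/.conj/.apply_T_eq` (an eigensystem
associated with `ρ` is determined on the `T_{v,i}`, `v ∉ S`, by `ρ` — Chebotarev-free half of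
[cite: EmertonCoatesPAMQ2006, Rem. 7.3.3]), `IsAssociated.charpoly_eq_map_satakePolynomial`
(at an eigensystem with Satake-normalised eigenvalues the geometric Frobenius polynomial is
`∏ (X - f(q^{(n-1)/2} α_j))`), `isAssociated_two_iff`, `IsProModular.baseChange/.conj`.

## Design notes (what is deliberately NOT here)

* Pro-modularity is RELATIVE to the datum. An absolute "pro-modular of SOME tame level"
  (second paragraph of [cite: EmertonCoatesPAMQ2006, Def. 7.3.15]) must quantify over the
  completed-cohomology data of the tame levels `K^p`, never over abstract `HeckeDatum`s (for the
  tautological datum `𝕋 = E` every unramified-outside-`S` `ρ` would qualify). The finite-level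
  criterion ([cite: EmertonCoatesPAMQ2006, Lemma 7.3.13]: a `θ`-eigenvector in `Ĥ¹(K^p)_{E'}`
  makes `θ` promodular; torsion version: `θ mod ϖ^t` factors through the image of `𝕋^S` in
  `End H^•(Y(K^pK_p), 𝒪/ϖ^t)` for small `K_p`) is a statement about that construction and is left
  to it.
* Frobenius convention: GEOMETRIC Frobenius (`IsGeomFrobAt σ 𝔓 ↔ IsArithFrobAt σ⁻¹ 𝔓`), as in
  Emerton's `Frob_ℓ⁻¹`, Scholze's `D(1 - X Frob_v)` ([cite: Scholze2015, Thm. V.4.1 and Cor. V.4.3],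
  whose `T_{i,v}` are the elementary symmetric functions of the Satake variables and whose
  determinant is twisted by one power of `N v` relative to the double-coset normalisation used
  here) and Harris–Lan–Taylor–Thorne; the tree's `FramedGaloisRep.HasFrobCharpolyAt` is the
  ARITHMETIC convention, whose polynomial has the inverse roots.
* Coefficients: `ρ` is a framed representation over any topological commutative ring `E`
  (`ℚ̄_p = PadicAlgCl p`, a finite `E/ℚ_p`, `𝒪_E`, `𝒪_E/ϖ^t`, a complete local ring for
  deformations). Chenevier determinants / pseudo-representations valued in `𝕋` (the form in which
  torsion eigensystems carry Galois data, [cite: Scholze2015, Cor. V.4.4]) are not in the tree and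
  are not used.
* `ℕ`-arithmetic in `geomFrobPolyOfHecke`: `i * (i - 1) / 2` is the exact binomial coefficient
  and `n - i` has `i ≤ n` inside the sum (same expression as the tree's `heckePolynomial`).
-/

noncomputable section

open scoped NumberField Polynomial
open Polynomial IsDedekindDomain Field
open Literature.NumberTheory.GaloisRepresentations

namespace Literature.NumberTheory.Automorphic

universe u v w

/-! ### The Hecke polynomial over a general coefficient ring -/

section HeckePoly

variable {R : Type u} [CommRing R]

/-- The **polynomial of geometric Frobenius predicted by Hecke eigenvalues** `t_0 = 1, t_1, …, t_n`
of the double-coset operators `T_i = [GL_n(𝒪) diag(ϖ,…,ϖ,1,…,1) GL_n(𝒪)]` (`i` entries `ϖ`):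
`∑_{i=0}^{n} (-1)^i q^{i(i-1)/2} t_i X^{n-i} ∈ R[X]`, over any commutative ring `R` (Hecke
eigenvalues of torsion classes live in `ℤ/p^s`-algebras). For `R = ℂ` this is the tree's
`heckePolynomial` (`geomFrobPolyOfHecke_eq_heckePolynomial`), equal to `∏_j (X - q^{(n-1)/2} α_j)`
for Satake-normalised `t_i = q^{i(n-i)/2} e_i(α)` (Tamagawa; Shimura Thm. 3.21); it is the
characteristic polynomial of a geometric Frobenius on the Galois representation attached to the
eigensystem (Hansen, Def. 1.2.1, written there as `det(I - X ρ(Frob_v)) = ∑ (-1)^i Nv^{i(i-1)/2}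
φ(T_{v,i}) X^i`). `i * (i - 1) / 2` is the exact binomial coefficient; only `t_0, …, t_n` are
used. [cite: ShimuraIATAF1971, Theorem 3.21] -/
def geomFrobPolyOfHecke (q n : ℕ) (t : ℕ → R) : R[X] :=
  ∑ i ∈ Finset.range (n + 1), C ((-1) ^ i * (q : R) ^ (i * (i - 1) / 2) * t i) * X ^ (n - i)

/-- Over `ℂ`, `geomFrobPolyOfHecke` is the tree's `heckePolynomial` (same expression). [folklore] -/
theorem geomFrobPolyOfHecke_eq_heckePolynomial (q n : ℕ) (t : ℕ → ℂ) :
    geomFrobPolyOfHecke q n t = heckePolynomial q n t :=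
  rfl

/-- `geomFrobPolyOfHecke` only depends on `t_0, …, t_n`. [folklore] -/
theorem geomFrobPolyOfHecke_congr {q n : ℕ} {t t' : ℕ → R} (h : ∀ i ≤ n, t i = t' i) :
    geomFrobPolyOfHecke q n t = geomFrobPolyOfHecke q n t' := by
  refine Finset.sum_congr rfl fun i hi => ?_
  rw [h i (Nat.lt_succ_iff.mp (Finset.mem_range.mp hi))]

/-- `geomFrobPolyOfHecke` commutes with ring homomorphisms of the coefficients (reduction modulo
`ϖ^t`, extension of scalars, `ι⁻¹ : ℂ → ℚ̄_p` on algebraic values). [folklore] -/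
theorem geomFrobPolyOfHecke_map {S : Type v} [CommRing S] (f : R →+* S) (q n : ℕ) (t : ℕ → R) :
    (geomFrobPolyOfHecke q n t).map f = geomFrobPolyOfHecke q n (f ∘ t) := by
  rw [geomFrobPolyOfHecke, geomFrobPolyOfHecke, Polynomial.map_sum]
  refine Finset.sum_congr rfl fun i _ => ?_
  rw [Polynomial.map_mul, Polynomial.map_pow, map_X, map_C, map_mul f, map_mul f, map_pow f,
    map_pow f, map_neg f, map_one f, map_natCast f]
  rfl

/-- The coefficient of `X^{n-i}` in `geomFrobPolyOfHecke q n t` is `(-1)^i q^{i(i-1)/2} t_i`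
(`i ≤ n`). [folklore] -/
theorem coeff_geomFrobPolyOfHecke (q n : ℕ) (t : ℕ → R) {i : ℕ} (hi : i ≤ n) :
    (geomFrobPolyOfHecke q n t).coeff (n - i) = (-1) ^ i * (q : R) ^ (i * (i - 1) / 2) * t i := by
  rw [geomFrobPolyOfHecke, finsetSum_coeff]
  simp_rw [coeff_C_mul, coeff_X_pow]
  rw [Finset.sum_eq_single i]
  · simp
  · intro j hj hji
    rw [Finset.mem_range] at hj
    have : n - i ≠ n - j := by omega
    simp [this]
  · intro h
    exact absurd (Finset.mem_range.mpr (Nat.lt_succ_of_le hi)) h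

/-- Rank two: `geomFrobPolyOfHecke q 2 t = X² - t_1 X + q t_2` when `t_0 = 1` — the classical
`X² - T_v X + (N v) S_v`. [folklore] -/
theorem geomFrobPolyOfHecke_two (q : ℕ) (t : ℕ → R) (h0 : t 0 = 1) :
    geomFrobPolyOfHecke q 2 t = X ^ 2 - C (t 1) * X + C ((q : R) * t 2) := by
  simp only [geomFrobPolyOfHecke, Finset.sum_range_succ, Finset.sum_range_zero, h0, map_mul,
    map_pow, map_neg, map_one, map_natCast]
  norm_num
  ring

/-- **Tamagawa's identity transported along a ring homomorphism `f : ℂ → R`.** If the `t_i`,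
`i ≤ n`, are the Satake-normalised eigenvalues `q^{i(n-i)/2} e_i(α)` of a parameter `α` with `n`
entries, then `geomFrobPolyOfHecke q n (f ∘ t) = f(∏_j (X - q^{(n-1)/2} α_j))`: the predicted
geometric Frobenius has eigenvalues `f(q^{(n-1)/2} α_j)` (the tree's
`heckePolynomial_eq_satakePolynomial_holds`, Shimura Thm. 3.21, and `geomFrobPolyOfHecke_map`).
[cite: ShimuraIATAF1971, Theorem 3.21] -/
theorem geomFrobPolyOfHecke_of_satake (f : ℂ →+* R) (q n : ℕ) (t : ℕ → ℂ) (α : Multiset ℂ)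
    (ht : ∀ i ≤ n, t i = ((Real.sqrt q : ℝ) : ℂ) ^ (i * (n - i)) * α.esymm i)
    (hα : Multiset.card α = n) :
    geomFrobPolyOfHecke q n (f ∘ t) =
      (satakePolynomial (α.map fun a => ((Real.sqrt q : ℝ) : ℂ) ^ (n - 1) * a)).map f := by
  rw [← geomFrobPolyOfHecke_map, geomFrobPolyOfHecke_eq_heckePolynomial,
    heckePolynomial_eq_satakePolynomial_holds q n t α ht hα]

end HeckePoly

/-! ### Hecke data: the interface of a big Hecke algebra -/

/-- A **Hecke datum** for `GL_n` over the number field `K` on the commutative ring `𝕋`: a finite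
set `S` of bad finite places and, for every finite place `v` (used only for `v ∉ S`), elements
`T v i ∈ 𝕋` (used only for `1 ≤ i ≤ n`; `T v 0 = 1`), the images of the spherical double-coset
operators `T_{v,i} = [GL_n(𝒪_v) diag(ϖ_v,…,ϖ_v,1,…,1) GL_n(𝒪_v)]` (`i` entries `ϖ_v`). The
intended instance is Emerton's big Hecke algebra of completed cohomology of tame level `K^p`,
`𝕋(K^p) = lim_{s,K_p} im(𝕋^S → End ⊕_i H^i(Y(K^pK_p), 𝒪/ϖ^s))` with its projective-limit
topology and `S = S(K^p) ∪ {v ∣ p}` (Emerton, PAMQ 2 (2006), Def. 7.3.9 and (61); Pan, Def.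
3.3.4; Hansen §1.1, §4.6 for the operators); this structure records only what the notion of
pro-modularity consumes, and a `HeckeDatum` by itself asserts nothing.
[cite: EmertonCoatesPAMQ2006, Def. 7.3.9] -/
structure HeckeDatum (K : Type u) [Field K] [NumberField K] (n : ℕ) (𝕋 : Type v) [CommRing 𝕋]
    where
  /-- The finite set of bad places (`S(K^p)` together with the places above `p`). -/
  S : Set (HeightOneSpectrum (𝓞 K))
  /-- `S` is finite. -/
  S_finite : S.Finite
  /-- The Hecke operators `T_{v,i}`, meaningful for `v ∉ S` and `1 ≤ i ≤ n`. -/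
  T : HeightOneSpectrum (𝓞 K) → ℕ → 𝕋
  /-- `T_{v,0} = [GL_n(𝒪_v) · 1 · GL_n(𝒪_v)] = 1`. -/
  T_zero : ∀ v, T v 0 = 1

namespace HeckeDatum

variable {K : Type u} [Field K] [NumberField K] {n : ℕ} {𝕋 : Type v} [CommRing 𝕋]
variable {E : Type w} [CommRing E]

/-- The **Frobenius polynomial at `v` of an eigensystem** `θ : 𝕋 → E` of the Hecke datum `H`:
`∑_{i=0}^{n} (-1)^i (N v)^{i(i-1)/2} θ(T_{v,i}) X^{n-i}` (`geomFrobPolyOfHecke` at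
`q = N v = v.residueCard`), the predicted characteristic polynomial of a geometric Frobenius at
`v` (Hansen, Def. 1.2.1). [cite: HansenUniversalEigenvarieties2017, Def. 1.2.1] -/
def frobPoly (H : HeckeDatum K n 𝕋) (θ : 𝕋 →+* E) (v : HeightOneSpectrum (𝓞 K)) : E[X] :=
  geomFrobPolyOfHecke v.residueCard n fun i => θ (H.T v i)

/-- `frobPoly` commutes with ring homomorphisms of the coefficients. [folklore] -/
theorem frobPoly_map {E' : Type*} [CommRing E'] (H : HeckeDatum K n 𝕋) (θ : 𝕋 →+* E)
    (f : E →+* E') (v : HeightOneSpectrum (𝓞 K)) :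
    (H.frobPoly θ v).map f = H.frobPoly (f.comp θ) v :=
  geomFrobPolyOfHecke_map f _ _ _

/-- **`ρ` and `θ` are associated** (Hansen, Def. 1.2.1; Emerton, PAMQ 2 (2006), Def. 7.3.2 for
`n = 2`): the framed Galois representation `ρ : Γ_K → GL_n(E)` is unramified at every finite place
`v ∉ H.S`, and for every such `v`, every prime `𝔓 ∣ v` of `\bar ℤ_K` and every GEOMETRIC
Frobenius `σ` at `𝔓` (`IsGeomFrobAt`: `σ⁻¹ x ≡ x^{N v} mod 𝔓`), the characteristic polynomial
`det(X - ρ(σ))` is the Frobenius polynomial `∑ (-1)^i (N v)^{i(i-1)/2} θ(T_{v,i}) X^{n-i}` of the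
eigensystem `θ : 𝕋 → E` (`frobPoly`). No continuity is asked of `θ` here (see `IsProModular`).
[cite: HansenUniversalEigenvarieties2017, Def. 1.2.1] -/
def IsAssociated [TopologicalSpace E] (H : HeckeDatum K n 𝕋) (θ : 𝕋 →+* E)
    (ρ : FramedGaloisRep K E n) : Prop :=
  ∀ v ∉ H.S, ρ.IsUnramifiedAt v ∧
    ∀ 𝔓 ∈ v.primesAbove, ∀ σ : absoluteGaloisGroup K, IsGeomFrobAt (𝓞 K) σ 𝔓 →
      FramedRep.charpoly ρ σ = H.frobPoly θ v

end HeckeDatum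

section Defs

variable {K : Type u} [Field K] [NumberField K] {n : ℕ} {𝕋 : Type v} [CommRing 𝕋]
  [TopologicalSpace 𝕋]
variable {E : Type w} [CommRing E] [TopologicalSpace E]

/-- **Pro-modularity relative to a big Hecke algebra** (Emerton, PAMQ 2 (2006), Def. 7.3.11 and
Def. 7.3.15; Hansen, Def. 1.2.1 with Conj. 1.2.3): the framed Galois representation
`ρ : Γ_K → GL_n(E)` is **pro-modular with respect to the Hecke datum `H` on the topological ring
`𝕋`** if there is a CONTINUOUS ring homomorphism `θ : 𝕋 → E` (an `E`-valued eigensystem of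
`𝕋`, i.e. an `E`-point of `𝕋`) associated with `ρ` (`HeckeDatum.IsAssociated`: `ρ` unramified
outside `H.S` and `det(X - ρ(Frob_v)) = ∑ (-1)^i (N v)^{i(i-1)/2} θ(T_{v,i}) X^{n-i}` for
geometric Frobenii at `v ∉ H.S`). For `H` the datum of Emerton's completed-cohomology Hecke
algebra `𝕋(K^p)` this is "`ρ` is pro-modular of tame level `K^p`" (Emerton: "`λ` is promodular
if it is the composite of `𝕋 → 𝕋̃(K^p)` with a continuous `λ̃ : 𝕋̃(K^p) → A`", "`V` is
promodular if its associated system of Hecke eigenvalues is"); Hansen's `𝒳[ρ] ≠ ∅` (Conj.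
1.2.3) is its finite-slope refinement. The notion is relative to `H`: quantify over the
completed-cohomology data, never over abstract data, to say "of some tame level".
[cite: EmertonCoatesPAMQ2006, Def. 7.3.11 and Def. 7.3.15] -/
def IsProModular (H : HeckeDatum K n 𝕋) (ρ : FramedGaloisRep K E n) : Prop :=
  ∃ θ : 𝕋 →+* E, Continuous θ ∧ H.IsAssociated θ ρ

/-- Unfolding lemma for `IsProModular`. [folklore] -/
theorem isProModular_iff (H : HeckeDatum K n 𝕋) (ρ : FramedGaloisRep K E n) :
    IsProModular H ρ ↔ ∃ θ : 𝕋 →+* E, Continuous θ ∧ H.IsAssociated θ ρ :=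
  Iff.rfl

end Defs

/-! ### Change of coefficients, change of frame, uniqueness, rank two, classical eigenvalues -/

namespace HeckeDatum

variable {K : Type u} [Field K] [NumberField K] {n : ℕ} {𝕋 : Type v} [CommRing 𝕋]
variable {E : Type w} [CommRing E]

/-- The matrix underlying `Matrix.GeneralLinearGroup.map f g` is the entrywise image. [folklore] -/
theorem coe_generalLinearGroup_map {m : Type*} [Fintype m] [DecidableEq m] {S : Type*} [CommRing S]
    (f : E →+* S) (g : GL m E) :
    ((Matrix.GeneralLinearGroup.map f g : GL m S) : Matrix m m S) = (g : Matrix m m E).map f :=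
  Matrix.ext fun i j => Matrix.GeneralLinearGroup.map_apply f i j g

variable [TopologicalSpace E]
variable {H : HeckeDatum K n 𝕋} {θ : 𝕋 →+* E} {ρ : FramedGaloisRep K E n}

/-- **Association is compatible with change of coefficients**: if `θ` is associated with `ρ` and
`f : E → E'` is a continuous ring homomorphism, then `f ∘ θ` is associated with the base change
`f ∘ ρ` (`FramedRep.baseChange`). With `f` the reduction `𝒪_E → 𝒪_E/ϖ^t` this is the passage
from an integral eigensystem to its reductions (Emerton, PAMQ 2 (2006), Def. 7.3.2 is stated over
any `𝒪_E`-algebra). [folklore] -/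
theorem IsAssociated.baseChange {E' : Type*} [CommRing E'] [TopologicalSpace E']
    (h : H.IsAssociated θ ρ) (f : E →+* E') (hf : Continuous f) :
    H.IsAssociated (f.comp θ) (FramedRep.baseChange f hf ρ) := by
  intro v hv
  refine ⟨fun 𝔓 h𝔓 σ hσ => ?_, fun 𝔓 h𝔓 σ hσ => ?_⟩
  · rw [FramedRep.baseChange_apply, (h v hv).1 𝔓 h𝔓 σ hσ, map_one]
  · rw [← frobPoly_map, ← (h v hv).2 𝔓 h𝔓 σ hσ, FramedRep.charpoly, FramedRep.charpoly,
      FramedRep.baseChange_apply, coe_generalLinearGroup_map, Matrix.charpoly_map]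

/-- **Association is invariant under change of frame** `ρ ↦ P ρ P⁻¹` (`FramedRep.conj`):
unramifiedness is (`FramedGaloisRep.isUnramifiedAt_conj_iff`) and characteristic polynomials are
(`Matrix.charpoly_units_conj`). [folklore] -/
theorem IsAssociated.conj [IsTopologicalRing E] (h : H.IsAssociated θ ρ) (P : GL (Fin n) E) :
    H.IsAssociated θ (FramedRep.conj P ρ) := by
  intro v hv
  refine ⟨(FramedGaloisRep.isUnramifiedAt_conj_iff v P ρ).mpr (h v hv).1, fun 𝔓 h𝔓 σ hσ => ?_⟩
  rw [← (h v hv).2 𝔓 h𝔓 σ hσ, FramedRep.charpoly, FramedRep.charpoly, FramedRep.conj_apply,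
    Units.val_mul, Units.val_mul, Matrix.coe_units_inv, Matrix.charpoly_units_conj]

/-- **An associated eigensystem is determined by `ρ` on the Hecke operators**: if `θ` and `θ'`
are both associated with `ρ`, then `θ(T_{v,i}) = θ'(T_{v,i})` for `v ∉ S` and `i ≤ n`, provided
`N v` is a unit in `E` (true in `ℚ̄_p`, and in `𝒪/ϖ^t` for `v ∤ p`): a geometric Frobenius at
`v` exists (`exists_isArithFrobAt_of_mem_primesAbove_holds`), and the two Frobenius polynomials are
then both `det(X - ρ(Frob_v))`; compare coefficients. (The converse direction, that `θ`
determines `ρ` up to semisimplification, is Chebotarev + Brauer–Nesbitt, Emerton Rem. 7.3.3,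
and is not claimed.) [folklore] -/
theorem IsAssociated.apply_T_eq {θ' : 𝕋 →+* E} (h : H.IsAssociated θ ρ)
    (h' : H.IsAssociated θ' ρ) {v : HeightOneSpectrum (𝓞 K)} (hv : v ∉ H.S)
    (hq : IsUnit ((v.residueCard : ℕ) : E)) {i : ℕ} (hi : i ≤ n) :
    θ (H.T v i) = θ' (H.T v i) := by
  obtain ⟨𝔓, h𝔓⟩ := HeightOneSpectrum.primesAbove_nonempty v
  obtain ⟨σ, hσ⟩ := HeightOneSpectrum.exists_isArithFrobAt_of_mem_primesAbove_holds h𝔓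
  have hgeom : IsGeomFrobAt (𝓞 K) σ⁻¹ 𝔓 := isGeomFrobAt_inv_iff.mpr hσ
  have hpoly : H.frobPoly θ v = H.frobPoly θ' v := by
    rw [← (h v hv).2 𝔓 h𝔓 σ⁻¹ hgeom, (h' v hv).2 𝔓 h𝔓 σ⁻¹ hgeom]
  have hcoeff := congrArg (fun P : E[X] => P.coeff (n - i)) hpoly
  simp only [frobPoly, coeff_geomFrobPolyOfHecke _ _ _ hi] at hcoeff
  have hu : IsUnit ((-1 : E) ^ i * ((v.residueCard : ℕ) : E) ^ (i * (i - 1) / 2)) :=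
    ((isUnit_one.neg).pow i).mul (hq.pow _)
  exact hu.mul_left_cancel hcoeff

/-- **Rank two** (Emerton, PAMQ 2 (2006), Def. 7.3.2: `λ(T_ℓ) = trace(Frob_ℓ⁻¹ | V)`,
`λ(ℓ S_ℓ) = det(Frob_ℓ⁻¹ | V)`, `Frob_ℓ` arithmetic, so `Frob_ℓ⁻¹` geometric; Hansen §4.6:
`T_v = T_{v,1}`, `S_v = T_{v,2}`): `θ` is associated with `ρ : Γ_K → GL₂(E)` iff `ρ` is
unramified outside `S` and every geometric Frobenius `σ` at `v ∉ S` has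
`tr ρ(σ) = θ(T_v)` and `det ρ(σ) = (N v) · θ(S_v)` (`Matrix.charpoly_fin_two`).
[cite: EmertonCoatesPAMQ2006, Def. 7.3.2] -/
theorem isAssociated_two_iff [Nontrivial E] (H : HeckeDatum K 2 𝕋) (θ : 𝕋 →+* E)
    (ρ : FramedGaloisRep K E 2) :
    H.IsAssociated θ ρ ↔ ∀ v ∉ H.S, ρ.IsUnramifiedAt v ∧
      ∀ 𝔓 ∈ v.primesAbove, ∀ σ : absoluteGaloisGroup K, IsGeomFrobAt (𝓞 K) σ 𝔓 →
        ((ρ σ : GL (Fin 2) E) : Matrix (Fin 2) (Fin 2) E).trace = θ (H.T v 1) ∧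
        ((ρ σ : GL (Fin 2) E) : Matrix (Fin 2) (Fin 2) E).det =
          ((v.residueCard : ℕ) : E) * θ (H.T v 2) := by
  have hpoly : ∀ v, H.frobPoly θ v =
      X ^ 2 - C (θ (H.T v 1)) * X + C (((v.residueCard : ℕ) : E) * θ (H.T v 2)) := fun v =>
    geomFrobPolyOfHecke_two _ _ (by rw [H.T_zero, map_one])
  refine forall₂_congr fun v _ => and_congr Iff.rfl ?_
  refine forall₂_congr fun 𝔓 _ => forall₂_congr fun σ _ => ?_
  rw [hpoly, FramedRep.charpoly, Matrix.charpoly_fin_two]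
  constructor
  · intro h
    have h0 := congrArg (fun P : E[X] => P.coeff 0) h
    have h1 := congrArg (fun P : E[X] => P.coeff 1) h
    simp only [coeff_add, coeff_sub, coeff_X_pow, coeff_C_mul, coeff_X, coeff_C] at h0 h1
    norm_num at h0 h1
    exact ⟨h1, h0⟩
  · rintro ⟨htr, hdet⟩
    rw [htr, hdet]

/-- **Classical eigenvalues.** If `θ` is associated with `ρ` and at `v ∉ S` the eigenvalues
`θ(T_{v,i})`, `i ≤ n`, are `f(q_v^{i(n-i)/2} e_i(α))` for a ring homomorphism `f : ℂ → E`
(e.g. `ι⁻¹` on a classical point with Satake parameter `α`, the normalisation of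
`AutomorphicRepData.HasSatakeParamAt`) and `#α = n`, then every geometric Frobenius at `v` has
characteristic polynomial `f(∏_j (X - q_v^{(n-1)/2} α_j))`, i.e. eigenvalues
`f(q_v^{(n-1)/2} α_j)` — the Harris–Lan–Taylor–Thorne normalisation of lang.S27 (whose
`arithFrobPolyOfSatake ι q_v n α` lists the inverse roots for the arithmetic Frobenius).
Tamagawa's identity, Shimura Thm. 3.21. [cite: ShimuraIATAF1971, Theorem 3.21] -/
theorem IsAssociated.charpoly_eq_map_satakePolynomial (h : H.IsAssociated θ ρ) (f : ℂ →+* E)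
    {v : HeightOneSpectrum (𝓞 K)} (hv : v ∉ H.S) {α : Multiset ℂ} (hα : Multiset.card α = n)
    (hT : ∀ i ≤ n, θ (H.T v i) =
      f (((Real.sqrt (v.residueCard : ℝ) : ℝ) : ℂ) ^ (i * (n - i)) * α.esymm i))
    {𝔓 : Ideal (absIntegers (𝓞 K) K)} (h𝔓 : 𝔓 ∈ v.primesAbove) {σ : absoluteGaloisGroup K}
    (hσ : IsGeomFrobAt (𝓞 K) σ 𝔓) :
    FramedRep.charpoly ρ σ =
      (satakePolynomial
        (α.map fun a => ((Real.sqrt (v.residueCard : ℝ) : ℝ) : ℂ) ^ (n - 1) * a)).map f := by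
  rw [(h v hv).2 𝔓 h𝔓 σ hσ, frobPoly,
    geomFrobPolyOfHecke_congr (t' := f ∘ fun i =>
      ((Real.sqrt (v.residueCard : ℝ) : ℝ) : ℂ) ^ (i * (n - i)) * α.esymm i) hT]
  exact geomFrobPolyOfHecke_of_satake f _ n _ α (fun i _ => rfl) hα

end HeckeDatum

section ProModularAPI

variable {K : Type u} [Field K] [NumberField K] {n : ℕ} {𝕋 : Type v} [CommRing 𝕋]
  [TopologicalSpace 𝕋]
variable {E : Type w} [CommRing E] [TopologicalSpace E]
variable {H : HeckeDatum K n 𝕋} {ρ : FramedGaloisRep K E n}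

/-- **Pro-modularity is preserved by continuous change of coefficients** (`E → E'`, e.g.
`𝒪_E → 𝒪_E/ϖ^t`, `E ↪ E'`): compose the eigensystem with `f`. [folklore] -/
theorem IsProModular.baseChange {E' : Type*} [CommRing E'] [TopologicalSpace E']
    (h : IsProModular H ρ) (f : E →+* E') (hf : Continuous f) :
    IsProModular H (FramedRep.baseChange f hf ρ) := by
  obtain ⟨θ, hθ, hass⟩ := h
  exact ⟨f.comp θ, hf.comp hθ, hass.baseChange f hf⟩

/-- **Pro-modularity is invariant under change of frame** `ρ ↦ P ρ P⁻¹`: it is a property of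
the underlying representation. [folklore] -/
theorem IsProModular.conj [IsTopologicalRing E] (h : IsProModular H ρ) (P : GL (Fin n) E) :
    IsProModular H (FramedRep.conj P ρ) := by
  obtain ⟨θ, hθ, hass⟩ := h
  exact ⟨θ, hθ, hass.conj P⟩

end ProModularAPI

end Literature.NumberTheory.Automorphic
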